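import Mathlib
import HarnessLib
import Literature.MathematicalPhysics.QuantumLattice.HubbardOneParticleCost
import Literature.MathematicalPhysics.QuantumLattice.PairCorrelationsProofs

/-!
# Route `EnslavedA1g`, support `EnslavedA1gUpperSandwich` (item `stmt-HubbardSuperconductivity-0938`):
# locality bounds for commutators, abstract part (helper file 3/5)

The two `O(L²)` inputs of the Koma–Tasaki step of the upper sandwich, for the pair field
`Δ_g = Σ_x P_x` (`pairField g L`, `L²` local pair operators `P_x = localPair g L x`) and the
Hubbard Hamiltonian `H = hubbardTorus 2 L 1 U = Σ_Z h_Z` (the tree's local decomposition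
`hubbardTermOp`) on the torus `(ℤ/Lℤ)²`:

* `exists_commutator_pairField_bound` — `|⟨ψ, (Δ_g Δ_g† - Δ_g† Δ_g) ψ⟩| ≤ c_g L²`;
* `exists_doubleCommutator_pairField_bound` —
  `|⟨ψ, (Δ_g† [H, Δ_g] - [H, Δ_g] Δ_g†) ψ⟩| ≤ d_g(U) L²`,

for unit `ψ`, with constants independent of `L` — proved in the companion file
`EnslavedA1gUpperSandwichLocalityTorus`. THIS file holds the abstract bookkeeping (graded locality,
Bratteli–Robinson II §5.2.2, `commute_of_mem_carEvenSubalgebra`): for families of even local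
operators `a_x`, local `b_y` and even local terms `h_Z` with bounded overlap counts,
`norm_sum_sum_commutator_le` bounds `‖Σ_x Σ_y [a_x, b_y]‖` and `norm_sum_sum_doubleCommutator_le`
bounds `‖Σ_x Σ_y [b_y, [Σ_Z h_Z, a_x]]‖` linearly in the number of `x`; plus small CAR/norm helpers.

Sources: T. Koma, H. Tasaki, J. Stat. Phys. 76 (1994) 745 (double-commutator bounds for
translation sums); M. B. Hastings, T. Koma, CMP 265 (2006) 781, App. A; O. Bratteli,
D. W. Robinson, *Operator Algebras and QSM II* §5.2.2. All folklore.
-/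

noncomputable section

-- the mandated namespace `Summit.<Summit>.<Problem>.Theorems` repeats `HubbardSuperconductivity`
set_option linter.dupNamespace false

namespace Summit.HubbardSuperconductivity.HubbardSuperconductivity.Theorems.EnslavedA1g.UpperSandwich

open Matrix Finset
open Literature.Probability.LatticeModels Literature.MathematicalPhysics.QuantumLattice
open scoped ComplexOrder Matrix.Norms.L2Operator

/-! ### Abstract bookkeeping: sparse double sums of commutators in the CAR algebra -/

section Abstract

/-- Norm of a sparse sum: if `f` vanishes off `p` and is bounded by `C` on `p`, then
`‖Σ_{b ∈ s} f b‖ ≤ #{b ∈ s | p b} · C`. [folklore] -/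
theorem norm_sum_le_card_filter_mul {E : Type*} [SeminormedAddCommGroup E] {β : Type*}
    (s : Finset β) (p : β → Prop) [DecidablePred p] (f : β → E)
    (h0 : ∀ b ∈ s, ¬ p b → f b = 0) {C : ℝ} (hC : ∀ b ∈ s, p b → ‖f b‖ ≤ C) :
    ‖∑ b ∈ s, f b‖ ≤ (s.filter p).card * C := by
  have hs : ∑ b ∈ s.filter p, f b = ∑ b ∈ s, f b :=
    Finset.sum_filter_of_ne fun b hb hne => by
      by_contra hpb
      exact hne (h0 b hb hpb)
  rw [← hs]
  calc ‖∑ b ∈ s.filter p, f b‖ ≤ ∑ b ∈ s.filter p, ‖f b‖ := norm_sum_le _ _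
    _ ≤ ∑ _b ∈ s.filter p, C := Finset.sum_le_sum fun b hb =>
        hC b (Finset.mem_filter.1 hb).1 (Finset.mem_filter.1 hb).2
    _ = (s.filter p).card * C := by rw [Finset.sum_const, nsmul_eq_mul]

variable {ι : Type*} [LinearOrder ι] [Fintype ι]

/-- Graded locality as a vanishing commutator: an even element of `𝔄(S₁)` and an element of
`𝔄(S₂)`, `S₁ ∩ S₂ = ∅`, commute. Bratteli–Robinson II §5.2.2. [folklore] -/
theorem commutator_eq_zero_of_disjoint {S₁ S₂ : Finset ι} {p q : Matrix (Finset ι) (Finset ι) ℂ}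
    (hp : p ∈ carEvenSubalgebra S₁) (hq : q ∈ carSubalgebra S₂) (h : Disjoint S₁ S₂) :
    q * p - p * q = 0 :=
  sub_eq_zero.2 (commute_of_mem_carEvenSubalgebra hp hq h).eq.symm

variable {α : Type*} [Fintype α]

/-- **Locality bound for `[A, B]` with `A = Σ_x a_x` even-local and `B = Σ_y b_y` local**: if
every `a_x` meets at most `m` of the `b_y`, then `‖Σ_x Σ_y [a_x, b_y]‖ ≤ |α| · m · 2‖a‖‖b‖`.
Koma–Tasaki (1994); Bratteli–Robinson II §5.2.2. [folklore] -/
theorem norm_sum_sum_commutator_le (a b : α → Matrix (Finset ι) (Finset ι) ℂ) (W V : α → Finset ι)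
    (ha : ∀ x, a x ∈ carEvenSubalgebra (W x)) (hb : ∀ y, b y ∈ carSubalgebra (V y))
    {B C : ℝ} (hB0 : 0 ≤ B) (hC0 : 0 ≤ C) (hB : ∀ x, ‖a x‖ ≤ B) (hC : ∀ y, ‖b y‖ ≤ C) {m : ℕ}
    (hm : ∀ x, (Finset.univ.filter fun y => ¬ Disjoint (W x) (V y)).card ≤ m) :
    ‖∑ x, ∑ y, (a x * b y - b y * a x)‖ ≤ Fintype.card α * (m * (2 * B * C)) := by
  classical
  have hx : ∀ x, ‖∑ y, (a x * b y - b y * a x)‖ ≤ m * (2 * B * C) := by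
    intro x
    have h := norm_sum_le_card_filter_mul Finset.univ (fun y => ¬ Disjoint (W x) (V y))
      (fun y => a x * b y - b y * a x)
      (fun y _ hy => by
        rw [not_not] at hy
        rw [← neg_sub, commutator_eq_zero_of_disjoint (ha x) (hb y) hy, neg_zero])
      (C := 2 * B * C) (fun y _ _ => by
        calc ‖a x * b y - b y * a x‖ ≤ ‖a x * b y‖ + ‖b y * a x‖ := norm_sub_le _ _
          _ ≤ ‖a x‖ * ‖b y‖ + ‖b y‖ * ‖a x‖ := add_le_add (norm_mul_le _ _) (norm_mul_le _ _)
          _ ≤ B * C + C * B := add_le_add (mul_le_mul (hB x) (hC y) (norm_nonneg _) hB0)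
              (mul_le_mul (hC y) (hB x) (norm_nonneg _) hC0)
          _ = 2 * B * C := by ring)
    refine h.trans ?_
    have hmx : ((Finset.univ.filter fun y => ¬ Disjoint (W x) (V y)).card : ℝ) ≤ m := by
      exact_mod_cast hm x
    exact mul_le_mul_of_nonneg_right hmx (by positivity)
  calc ‖∑ x, ∑ y, (a x * b y - b y * a x)‖ ≤ ∑ x, ‖∑ y, (a x * b y - b y * a x)‖ := norm_sum_le _ _
    _ ≤ ∑ _x : α, (m * (2 * B * C) : ℝ) := Finset.sum_le_sum fun x _ => hx x
    _ = Fintype.card α * (m * (2 * B * C)) := by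
        rw [Finset.sum_const, Finset.card_univ, nsmul_eq_mul]

/-- **Locality bound for the double commutator `[B, [H, A]]`** with `H = Σ_Z h_Z` a sum of even
local terms: if every `a_x` meets at most `M` terms `h_Z`, and for each such pair at most `m` of
the `b_y` meet `supp h_Z ∪ supp a_x`, then
`‖Σ_x Σ_y (b_y [H, a_x] - [H, a_x] b_y)‖ ≤ |α| · M · m · 2‖b‖ · 2‖h‖‖a‖`.
Koma–Tasaki, J. Stat. Phys. 76 (1994) 745; Hastings–Koma (2006) App. A. [folklore] -/
theorem norm_sum_sum_doubleCommutator_le {ζ : Type*} [Fintype ζ]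
    (a b : α → Matrix (Finset ι) (Finset ι) ℂ) (W V : α → Finset ι)
    (h : ζ → Matrix (Finset ι) (Finset ι) ℂ) (T : ζ → Finset ι)
    (ha : ∀ x, a x ∈ carEvenSubalgebra (W x)) (hb : ∀ y, b y ∈ carSubalgebra (V y))
    (hh : ∀ Z, h Z ∈ carEvenSubalgebra (T Z))
    {B C J : ℝ} (hB0 : 0 ≤ B) (hC0 : 0 ≤ C) (hJ0 : 0 ≤ J) (hB : ∀ x, ‖a x‖ ≤ B)
    (hC : ∀ y, ‖b y‖ ≤ C) (hJ : ∀ Z, ‖h Z‖ ≤ J) {M m : ℕ}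
    (hM : ∀ x, (Finset.univ.filter fun Z => ¬ Disjoint (T Z) (W x)).card ≤ M)
    (hm : ∀ x Z, (Finset.univ.filter fun y => ¬ Disjoint (T Z ∪ W x) (V y)).card ≤ m) :
    ‖∑ x, ∑ y, (b y * ((∑ Z, h Z) * a x - a x * ∑ Z, h Z) -
        ((∑ Z, h Z) * a x - a x * ∑ Z, h Z) * b y)‖ ≤
      Fintype.card α * (M * (m * (2 * C * (2 * J * B)))) := by
  classical
  -- localise the inner commutator: only the terms meeting `supp a_x` survive
  have hloc : ∀ x, (∑ Z, h Z) * a x - a x * ∑ Z, h Z =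
      ∑ Z ∈ Finset.univ.filter (fun Z => ¬ Disjoint (T Z) (W x)), (h Z * a x - a x * h Z) := by
    intro x
    rw [finset_sum_commutator]
    exact (Finset.sum_filter_of_ne fun Z _ hne => by
      by_contra hd
      have hd' : Disjoint (T Z) (W x) := by simpa using hd
      exact hne (sub_eq_zero.2 (commute_of_mem_carEvenSubalgebra (hh Z)
        (carEvenSubalgebra_le_carSubalgebra _ (ha x)) hd').eq)).symm
  -- per `(x, Z)`: the sum over `y`
  have hinner : ∀ x Z, ‖∑ y, (b y * (h Z * a x - a x * h Z) - (h Z * a x - a x * h Z) * b y)‖ ≤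
      m * (2 * C * (2 * J * B)) := by
    intro x Z
    have hcZ : h Z * a x - a x * h Z ∈ carEvenSubalgebra (T Z ∪ W x) :=
      Subalgebra.sub_mem _
        (Subalgebra.mul_mem _ (carEvenSubalgebra_mono Finset.subset_union_left (hh Z))
          (carEvenSubalgebra_mono Finset.subset_union_right (ha x)))
        (Subalgebra.mul_mem _ (carEvenSubalgebra_mono Finset.subset_union_right (ha x))
          (carEvenSubalgebra_mono Finset.subset_union_left (hh Z)))
    have hnZ : ‖h Z * a x - a x * h Z‖ ≤ 2 * J * B := by
      calc ‖h Z * a x - a x * h Z‖ ≤ ‖h Z * a x‖ + ‖a x * h Z‖ := norm_sub_le _ _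
        _ ≤ ‖h Z‖ * ‖a x‖ + ‖a x‖ * ‖h Z‖ := add_le_add (norm_mul_le _ _) (norm_mul_le _ _)
        _ ≤ J * B + B * J := add_le_add (mul_le_mul (hJ Z) (hB x) (norm_nonneg _) hJ0)
            (mul_le_mul (hB x) (hJ Z) (norm_nonneg _) hB0)
        _ = 2 * J * B := by ring
    have hJB : 0 ≤ 2 * J * B := by positivity
    have h1 := norm_sum_le_card_filter_mul Finset.univ (fun y => ¬ Disjoint (T Z ∪ W x) (V y))
      (fun y => b y * (h Z * a x - a x * h Z) - (h Z * a x - a x * h Z) * b y)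
      (fun y _ hy => by
        rw [not_not] at hy
        exact commutator_eq_zero_of_disjoint hcZ (hb y) hy)
      (C := 2 * C * (2 * J * B)) (fun y _ _ => by
        calc ‖b y * (h Z * a x - a x * h Z) - (h Z * a x - a x * h Z) * b y‖
            ≤ ‖b y * (h Z * a x - a x * h Z)‖ + ‖(h Z * a x - a x * h Z) * b y‖ := norm_sub_le _ _
          _ ≤ ‖b y‖ * ‖h Z * a x - a x * h Z‖ + ‖h Z * a x - a x * h Z‖ * ‖b y‖ :=
              add_le_add (norm_mul_le _ _) (norm_mul_le _ _)
          _ ≤ C * (2 * J * B) + (2 * J * B) * C :=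
              add_le_add (mul_le_mul (hC y) hnZ (norm_nonneg _) hC0)
                (mul_le_mul hnZ (hC y) (norm_nonneg _) hJB)
          _ = 2 * C * (2 * J * B) := by ring)
    refine h1.trans ?_
    have hmx : ((Finset.univ.filter fun y => ¬ Disjoint (T Z ∪ W x) (V y)).card : ℝ) ≤ m := by
      exact_mod_cast hm x Z
    exact mul_le_mul_of_nonneg_right hmx (by positivity)
  -- per `x`
  have hx : ∀ x, ‖∑ y, (b y * ((∑ Z, h Z) * a x - a x * ∑ Z, h Z) -
      ((∑ Z, h Z) * a x - a x * ∑ Z, h Z) * b y)‖ ≤ M * (m * (2 * C * (2 * J * B))) := by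
    intro x
    rw [hloc x]
    set F := Finset.univ.filter (fun Z => ¬ Disjoint (T Z) (W x)) with hF
    have hrew : ∑ y, (b y * (∑ Z ∈ F, (h Z * a x - a x * h Z)) -
        (∑ Z ∈ F, (h Z * a x - a x * h Z)) * b y) =
        ∑ Z ∈ F, ∑ y, (b y * (h Z * a x - a x * h Z) - (h Z * a x - a x * h Z) * b y) := by
      rw [Finset.sum_comm]
      refine Finset.sum_congr rfl fun y _ => ?_
      rw [Finset.mul_sum, Finset.sum_mul, ← Finset.sum_sub_distrib]
    rw [hrew]
    calc ‖∑ Z ∈ F, ∑ y, (b y * (h Z * a x - a x * h Z) - (h Z * a x - a x * h Z) * b y)‖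
        ≤ ∑ Z ∈ F, ‖∑ y, (b y * (h Z * a x - a x * h Z) - (h Z * a x - a x * h Z) * b y)‖ :=
          norm_sum_le _ _
      _ ≤ ∑ _Z ∈ F, (m * (2 * C * (2 * J * B)) : ℝ) := Finset.sum_le_sum fun Z _ => hinner x Z
      _ = F.card * (m * (2 * C * (2 * J * B))) := by rw [Finset.sum_const, nsmul_eq_mul]
      _ ≤ M * (m * (2 * C * (2 * J * B))) :=
          mul_le_mul_of_nonneg_right (by exact_mod_cast hM x) (by positivity)
  calc ‖∑ x, ∑ y, (b y * ((∑ Z, h Z) * a x - a x * ∑ Z, h Z) -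
          ((∑ Z, h Z) * a x - a x * ∑ Z, h Z) * b y)‖
      ≤ ∑ x, ‖∑ y, (b y * ((∑ Z, h Z) * a x - a x * ∑ Z, h Z) -
          ((∑ Z, h Z) * a x - a x * ∑ Z, h Z) * b y)‖ := norm_sum_le _ _
    _ ≤ ∑ _x : α, (M * (m * (2 * C * (2 * J * B))) : ℝ) := Finset.sum_le_sum fun x _ => hx x
    _ = Fintype.card α * (M * (m * (2 * C * (2 * J * B)))) := by
        rw [Finset.sum_const, Finset.card_univ, nsmul_eq_mul]

/-- `c_i c_j` is an even element of the CAR algebra of any orbital set containing `i` and `j`.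
Bratteli–Robinson II §5.2.2. [folklore] -/
theorem annihilation_mul_annihilation_mem_carEvenSubalgebra {S : Finset ι} {i j : ι}
    (hi : i ∈ S) (hj : j ∈ S) : annihilation i * annihilation j ∈ carEvenSubalgebra S :=
  Algebra.subset_adjoin ⟨(i, false), (j, false), hi, hj, rfl⟩

/-- `|⟨ψ, M ψ⟩| ≤ ‖M‖` for a unit vector `ψ` (Cauchy–Schwarz with the operator norm). [folklore] -/
theorem norm_star_dotProduct_mulVec_le_of_unit (M : Matrix (Finset ι) (Finset ι) ℂ)
    {ψ : Finset ι → ℂ} (hψ : star ψ ⬝ᵥ ψ = 1) : ‖star ψ ⬝ᵥ (M *ᵥ ψ)‖ ≤ ‖M‖ := by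
  have hn : ‖(WithLp.toLp 2 ψ : EuclideanSpace ℂ (Finset ι))‖ = 1 := by
    have h := ThermodynamicLimit.norm_toLp_sq ψ
    rw [hψ, Complex.one_re] at h
    rwa [pow_eq_one_iff_of_nonneg (norm_nonneg _) two_ne_zero] at h
  have h := ThermodynamicLimit.norm_star_dotProduct_mulVec_le M ψ ψ
  rwa [hn, one_mul, mul_one] at h

/-- `Σ_y b_y · Σ_x C_x - Σ_x C_x · Σ_y b_y = Σ_x Σ_y (b_y C_x - C_x b_y)`. [folklore] -/
theorem sum_mul_sum_sub_sum_mul_sum {R : Type*} [NonUnitalNonAssocRing R] {β γ : Type*}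
    (s : Finset β) (t : Finset γ) (b : β → R) (C : γ → R) :
    (∑ y ∈ s, b y) * (∑ x ∈ t, C x) - (∑ x ∈ t, C x) * ∑ y ∈ s, b y =
      ∑ x ∈ t, ∑ y ∈ s, (b y * C x - C x * b y) := by
  rw [Finset.sum_mul_sum, Finset.sum_mul_sum, Finset.sum_comm, ← Finset.sum_sub_distrib]
  refine Finset.sum_congr rfl fun x _ => ?_
  rw [← Finset.sum_sub_distrib]

end Abstract

end Summit.HubbardSuperconductivity.HubbardSuperconductivity.Theorems.EnslavedA1g.UpperSandwich
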